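import Summits.BirchSwinnertonDyer.Rank1Residual.GaloisImage.PadicRootCensusSplitCover
import HarnessLib

/-!
# Root census with a DESCENT-COVER CERTIFICATE: the split cover of `RootCensus.check₃` made recursive —
# a residue class holding a MULTIPLE root mod `p` is accounted for by a Taylor shift-and-divide
# `F(r + pY) = p^e · F₁(Y)` and a certificate for `F₁` one level down (team n1011; seat p09 GEN 15;
# design input `W54-GATED-KIND-I-DESCENT.md` for route planner 1's gated W54 / W54-K rows; sequel of
# n1011-p17's `PadicRootCensus*` and n1011-p04's `PadicRootCensusSplitCover`, both used BY NAME)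

HONEST FRAMING (cell `b2b-bsdres`, run/shared/lean/b2b/bsd-rank1-residual/, verbatim in every
file): the goal of the cell is to DELETE the COMBINATION-SHAPED residual classes of the
Birch–Swinnerton-Dyer formula for ALL analytic-rank `≤ 1` elliptic curves over `ℚ` — "full BSD
formula for every rank `≤ 1` curve in class `C`" assembled STRICTLY from published theorems — so
that the rank-`≤ 1` remainder becomes exactly the CONSTRUCTION-SHAPED classes, which are TYPED
(missing-input `Prop`s), NOT attempted. This is not "finishing BSD". Team n1011 (N10/N11): research
route; this file is a TOOL (pure `p`-adic algebra); nothing is booked by it; no mark / label moved.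
No named fact, no `sorry`; the only definitions are COMPUTABLE bookkeeping (coefficient-list arithmetic,
the certificate tree `DCert`, the Boolean checkers `nodeOK` / `check₅`).

## Why a fifth checker

p04's split cover (`check₃`) accounts for a root residue `r` of `F mod p` EITHER by a certified simple
Hensel ball centred in the class of `r` OR by p17's Taylor exclusion at level `1`.  At the gated places of
route planner 1's W54 / W54-K rows (the partner's NONSPLIT `I₃` primes `q ≡ 1 (mod 3)`, five to seven
digits) `Ψ₃ ≡ 3 (X − x_t)(X − x₀)³ (mod q)` and the node class `x₀` is NEITHER: `v(Ψ₃⁽ⁱ⁾(x₀)/i!) = (3, 2, 1, 0, 0)`,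
so roots may sit two levels below `x₀` (they do for 317169b1's partner at `q = 659 671`: three Hensel balls
of depth `m = 2`).  The enumerative tree (`check₂`) would expand `q` residues below `x₀`.  THIS FILE descends
instead: with `F(x₀ + qY) = q³ · F₁(Y)` exactly over `ℤ`, every `ℤ_q`-root of `F` in the class of `x₀` is
`x₀ + q·t` with `F₁(t) = 0`, and `F₁ mod q` is again split-covered (recursively, with fuel).  Cost:
`deg F` coefficient identities per node, independent of `q`.
At the three other gated rows (partners of 384318n1 / 346734c1 / 460080a1) `F₁ mod q` has NO root; by route
planner 1's structure theorem D-55G (B) it is an AFFINE PURE CUBE `C((Y − s)³ − c′)` mod `q` (the three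
non-toral `3`-torsion pairs `ζ₃^a q_F^{1/3}` reduce to the node), root-free iff `c′` is a non-cube — the
`cubeDead` leaf: a dozen coefficient identities and ONE naive power `c′^{(q−1)/3} mod q`.
-- TODO(general form): a root-free cofactor NOT of cube-class shape (an irreducible quadratic / generic cubic
-- at a good prime) wants the Bezout certificate of p04's banked `PadicRootCensusFactorCover`.

## What

* `dilateList`, `smulList`, `congrList₀` (congruence mod `p` allowing a `p`-divisible tail), `descentOK`
  (`F(r + pY) = p^e F₁(Y)` coefficientwise) — computable; `aeval_ofList_dilateList`, `aeval_ofList_smulList`,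
  `dvd_aeval_sub_of_congrList₀`, **`aeval_descent`** (`aeval (r + p·t) F = p^e · aeval t F₁`);
* `DCert` (certificate tree: `node` = split factorisation + descents, `cubeDead` = route planner 1's
  CUBE-CLASS root-free leaf `L ≡ C((Y − s)³ − c′)`, `c′` a non-cube mod `p ≡ 1 (mod 3)`), `cubeList`,
  `cubeDeadOK`, `nodeOK` (fuelled checker), `check₅` = `entryOK` ∧ `pairwiseOK` ∧ `nodeOK`;
* `aeval_ne_zero_of_cubeDeadOK` (a cube-class leaf has no `ℤ_p`-root: reduce to `ZMod p`, Euler's cube test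
  `pow_div_three_eq_one_of_cube`);
* **`inBall_of_nodeOK`** — soundness of the descent cover (every root lies in a certified ball);
* **`exists_roots_of_check₅`** — the ROOT CENSUS for `check₅` (p17's `exists_roots_of_cover` BY NAME).
Consumers (`threeTorsionCertAt₅`, kinds) are a separate file.

References: Hensel's lemma (Mathlib `PadicInt`); cells/n1011/ROUTE-1.md §65.1 (D-31891), §66.5 (S-66W gated rows).
-/

set_option autoImplicit false

open Polynomial

namespace Summit.BirchSwinnertonDyer.Rank1Residual.GaloisImage.RootCensus

/-! ### Coefficient-list arithmetic of the descent -/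

/-- Coefficient list of the DILATION `F(p·Y)` from that of `F(Y)`: the `i`-th coefficient times `p^i` (named apart
from n1011-p04's banked scalar `scaleList`). [folklore] -/
def dilateList (p : ℤ) : List ℤ → List ℤ
  | [] => []
  | c :: l => c :: (dilateList p l).map (fun x => p * x)

/-- Coefficient list of `c · F`. [folklore] -/
def smulList (c : ℤ) (l : List ℤ) : List ℤ := l.map (fun x => c * x)

/-- Coefficientwise congruence modulo `p` of two coefficient lists, the FIRST possibly longer with a tail
of coefficients `≡ 0 (mod p)` (a polynomial whose degree drops mod `p`). [folklore] -/
def congrList₀ (p : ℕ) : List ℤ → List ℤ → Bool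
  | [], [] => true
  | c :: l, [] => (c % (p : ℤ) == 0) && congrList₀ p l []
  | [], _ :: _ => false
  | c :: l, c' :: l' => ((c - c') % (p : ℤ) == 0) && congrList₀ p l l'

/-- **The descent identity check**: `F(r + pY) = p^e · F₁(Y)` coefficientwise, `F = ofList l`,
`F₁ = ofList l₁`. [folklore] -/
def descentOK (p : ℕ) (l : List ℤ) (r : ℤ) (e : ℕ) (l₁ : List ℤ) : Bool :=
  dilateList p (taylorList l r) == smulList ((p : ℤ) ^ e) l₁

section Aeval

variable {A : Type*} [CommRing A] [Algebra ℤ A] (y : A)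

/-- `aeval y (ofList (l.map (c * ·))) = c · aeval y (ofList l)`. [folklore] -/
theorem aeval_ofList_map_mul (c : ℤ) : ∀ l : List ℤ,
    aeval y (ofList (l.map (fun x => c * x))) = (c : A) * aeval y (ofList l)
  | [] => by simp
  | d :: l => by
    rw [List.map_cons, aeval_ofList_cons, aeval_ofList_cons, aeval_ofList_map_mul c l]
    push_cast; ring

/-- `aeval y (ofList (smulList c l)) = c · aeval y (ofList l)`. [folklore] -/
theorem aeval_ofList_smulList (c : ℤ) (l : List ℤ) :
    aeval y (ofList (smulList c l)) = (c : A) * aeval y (ofList l) :=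
  aeval_ofList_map_mul y c l

/-- `aeval y (ofList (dilateList p l)) = aeval (p·y) (ofList l)`. [folklore] -/
theorem aeval_ofList_dilateList (p : ℤ) : ∀ l : List ℤ,
    aeval y (ofList (dilateList p l)) = aeval ((p : A) * y) (ofList l)
  | [] => by simp [dilateList]
  | c :: l => by
    rw [dilateList, aeval_ofList_cons, aeval_ofList_map_mul, aeval_ofList_dilateList p l, aeval_ofList_cons]
    ring

/-- Coefficientwise congruence (with a `p`-divisible tail) gives congruent values:
`p ∣ aeval y (ofList l) − aeval y (ofList l′)`. [folklore] -/
theorem dvd_aeval_sub_of_congrList₀ (p : ℕ) : ∀ (l l' : List ℤ), congrList₀ p l l' = true →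
    ((p : ℤ) : A) ∣ aeval y (ofList l) - aeval y (ofList l')
  | [], [], _ => by simp
  | [], _ :: _, h => by simp [congrList₀] at h
  | c :: l, [], h => by
    simp only [congrList₀, Bool.and_eq_true, beq_iff_eq, emod_eq_zero_iff_dvd'] at h
    obtain ⟨hc, hl⟩ := h
    have ih := dvd_aeval_sub_of_congrList₀ p l [] hl
    rw [aeval_ofList_nil, sub_zero] at ih
    rw [aeval_ofList_cons, aeval_ofList_nil, sub_zero]
    exact dvd_add (by obtain ⟨d, hd⟩ := hc; exact ⟨(d : A), by rw [hd]; push_cast; ring⟩)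
      (Dvd.dvd.mul_left ih y)
  | c :: l, c' :: l', h => by
    simp only [congrList₀, Bool.and_eq_true, beq_iff_eq, emod_eq_zero_iff_dvd'] at h
    obtain ⟨hc, hl⟩ := h
    have ih := dvd_aeval_sub_of_congrList₀ p l l' hl
    rw [aeval_ofList_cons, aeval_ofList_cons,
      show (c : A) + y * aeval y (ofList l) - ((c' : A) + y * aeval y (ofList l')) =
        ((c - c' : ℤ) : A) + y * (aeval y (ofList l) - aeval y (ofList l')) by push_cast; ring]
    exact dvd_add (by obtain ⟨d, hd⟩ := hc; exact ⟨(d : A), by rw [hd]; push_cast; ring⟩)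
      (Dvd.dvd.mul_left ih y)

/-- **The descent**: if `descentOK p l r e l₁` then `aeval (r + p·t) F = p^e · aeval t F₁`. [folklore] -/
theorem aeval_descent {p : ℕ} {l : List ℤ} {r : ℤ} {e : ℕ} {l₁ : List ℤ}
    (h : descentOK p l r e l₁ = true) (t : A) :
    aeval ((r : A) + (p : A) * t) (ofList l) = (p : A) ^ e * aeval t (ofList l₁) := by
  have hl : dilateList p (taylorList l r) = smulList ((p : ℤ) ^ e) l₁ := by
    simpa [descentOK] using h
  have h1 := aeval_ofList_dilateList t (p : ℤ) (taylorList l r)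
  rw [hl, aeval_ofList_smulList, aeval_ofList_taylorList] at h1
  push_cast at h1
  rw [show (r : A) + (p : A) * t = (p : A) * t + (r : A) by ring]
  exact h1.symm

end Aeval

/-! ### The certificate tree and its checker -/

/-- **A descent-cover certificate.** `node lc lin kids`: the factorisation `L ≡ lc · ∏_{(s,e) ∈ lin} (Y − s)^e (mod p)`
of the CURRENT (descended) polynomial `L`, and for the residues `s` that are neither ball-accounted nor
Taylor-dead a DESCENT `(s, e, L₁, child)` with `L(s + pY) = p^e · L₁(Y)` and a certificate `child` for `L₁`.
[folklore] -/
inductive DCert : Type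
  /-- A node: leading coefficient `lc`, linear factors `lin = [(sᵢ, eᵢ)]` of the current polynomial mod `p`,
  and the descents `kids = [(s, e, L₁, child)]`. -/
  | node (lc : ℤ) (lin : List (ℤ × ℕ)) (kids : List (ℤ × ℕ × List ℤ × DCert)) : DCert
  /-- A ROOT-FREE leaf in CUBE-CLASS form (route planner 1's D-55G (B)): the current polynomial is
  `≡ C · ((Y − s)³ − c′) (mod p)` with `p ≡ 1 (mod 3)`, `p ∤ C`, `p ∤ c′` and `c′` a NON-CUBE mod `p`
  (`c′^{(p−1)/3} ≢ 1`), so it has no root in `ℤ_p` at all. -/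
  | cubeDead (C s c' : ℤ) : DCert

/-- Ascending coefficient list of `(Y − s)³ − c′`. [folklore] -/
def cubeList (s c' : ℤ) : List ℤ := [-(s ^ 3) - c', 3 * s ^ 2, -3 * s, 1]

/-- **The cube-class root-free check** for the polynomial `L` (route planner 1's D-55G (d2)–(d3)):
`p ≡ 1 (mod 3)`, `p ∤ C`, `p ∤ c′`, `L ≡ C · ((Y − s)³ − c′) (mod p)` coefficientwise (tail `≡ 0`), and the
naive Euler-type power `(c′ mod p)^{(p−1)/3} mod p ≠ 1` (kernel GMP arithmetic). [folklore] -/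
def cubeDeadOK (p : ℕ) (L : List ℤ) (C s c' : ℤ) : Bool :=
  (p % 3 == 1) && !(C % (p : ℤ) == 0) && !(c' % (p : ℤ) == 0) &&
    congrList₀ p L (smulList C (cubeList s c')) &&
    !(((c' % (p : ℤ)).toNat ^ ((p - 1) / 3)) % p == 1)

/-- **The node checker** (fuelled recursion).  At coordinates `x = a + p^j · y` with current polynomial
`L` (in `y`): `p ∤ lc`, `L ≡ lc · ∏ (Y − s)^e (mod p)` (tail of `L` beyond the product `≡ 0`), and every
listed residue `s` is accounted for — an `x`-level certified ball of level `≤ j + 1` centred in the class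
of `a + p^j s` (`inBall`), or p17's Taylor exclusion at level `1` for `L` (`dead`), or a checked descent
to a child certificate at `(a + p^j s, j + 1, L₁)`; a `cubeDead` leaf says the current polynomial has no
root at all (`cubeDeadOK`). [folklore] -/
def nodeOK (p : ℕ) (cert : List (ℤ × ℕ × ℕ)) : ℕ → ℤ → ℕ → List ℤ → DCert → Bool
  | 0, _, _, _, _ => false
  | _ + 1, _, _, L, .cubeDead C s c' => cubeDeadOK p L C s c'
  | fuel + 1, a, j, L, .node lc lin kids =>
    !(lc % (p : ℤ) == 0) && congrList₀ p L (prodLinList lc lin) &&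
      lin.all fun se =>
        inBall p cert (j + 1) (a + (p : ℤ) ^ j * se.1) || dead p L 1 se.1 ||
          kids.any fun kd =>
            (kd.1 == se.1) && descentOK p L se.1 kd.2.1 kd.2.2.1 &&
              nodeOK p cert fuel (a + (p : ℤ) ^ j * se.1) (j + 1) kd.2.2.1 kd.2.2.2

/-- **The v5 root-census checker**: entries and disjointness as in p17's `check` / `check₂` / p04's
`check₃`, the residue cover by a descent-cover certificate read with `fuel` levels. [folklore] -/
def check₅ (p : ℕ) (l : List ℤ) (k : ℕ) (cert : List (ℤ × ℕ × ℕ)) (fuel : ℕ) (d : DCert) : Bool :=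
  cert.all (entryOK p l k) && pairwiseOK p cert && nodeOK p cert fuel 0 0 l d

/-! ### Soundness -/

variable {p : ℕ} [hp : Fact p.Prime]

/-- `‖z − r‖ ≤ p⁻¹` in `ℤ_p` means `z = r + p·t`. [folklore] -/
theorem exists_eq_add_mul_of_norm_le (z : ℤ_[p]) (r : ℤ_[p])
    (h : ‖z - r‖ ≤ (p : ℝ) ^ (-((0 + 1 : ℕ) : ℤ))) : ∃ t : ℤ_[p], z = r + (p : ℤ_[p]) * t := by
  rw [PadicInt.norm_le_pow_iff_mem_span_pow, Ideal.mem_span_singleton'] at h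
  obtain ⟨t, ht⟩ := h
  exact ⟨t, by rw [zero_add, pow_one] at ht; linear_combination -ht⟩

section CubeClass

variable {A : Type*} [CommRing A] [Algebra ℤ A]

/-- `aeval y (ofList (cubeList s c′)) = (y − s)³ − c′`. [folklore] -/
theorem aeval_ofList_cubeList (y : A) (s c' : ℤ) :
    aeval y (ofList (cubeList s c')) = (y - (s : A)) ^ 3 - (c' : A) := by
  simp only [cubeList, aeval_ofList_cons, aeval_ofList_nil]
  push_cast; ring

end CubeClass

/-- In `ZMod p` with `p ≡ 1 (mod 3)`: a non-zero CUBE `c = u³` has `c^{(p−1)/3} = 1`. [folklore] -/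
theorem pow_div_three_eq_one_of_cube {c u : ZMod p} (hp3 : p % 3 = 1) (hc : c ≠ 0) (hu : u ^ 3 = c) :
    c ^ ((p - 1) / 3) = 1 := by
  have hu0 : u ≠ 0 := by rintro rfl; exact hc (by rw [← hu]; ring)
  have h3 : 3 * ((p - 1) / 3) = p - 1 := Nat.mul_div_cancel' (by omega)
  rw [← hu, ← pow_mul, h3]
  exact ZMod.pow_card_sub_one_eq_one hu0

/-- **Soundness of the cube-class leaf**: if `cubeDeadOK p L C s c′` then `ofList L` has NO root in `ℤ_p`.
[folklore] -/
theorem aeval_ne_zero_of_cubeDeadOK {L : List ℤ} {C s c' : ℤ} (h : cubeDeadOK p L C s c' = true)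
    (t : ℤ_[p]) : aeval t (ofList L) ≠ 0 := by
  simp only [cubeDeadOK, Bool.and_eq_true, Bool.not_eq_true', beq_eq_false_iff_ne, ne_eq, beq_iff_eq,
    emod_eq_zero_iff_dvd'] at h
  obtain ⟨⟨⟨⟨hp3, hC⟩, hc'⟩, hcongr⟩, hpow⟩ := h
  intro ht
  -- reduce mod `p`: `t̄ := toZMod t` is a root of `L̄`, hence of `C · ((Y − s)³ − c′)`
  set tb : ZMod p := PadicInt.toZMod t with htb
  have hL : aeval tb (ofList L) = 0 := by
    rw [htb, show PadicInt.toZMod t = (PadicInt.toZMod (p := p)).toIntAlgHom t from rfl,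
      Polynomial.aeval_algHom_apply, ht, map_zero]
  have hdvd := dvd_aeval_sub_of_congrList₀ tb p L (smulList C (cubeList s c')) hcongr
  rw [hL, zero_sub, dvd_neg, aeval_ofList_smulList, aeval_ofList_cubeList] at hdvd
  have hp0 : ((p : ℤ) : ZMod p) = 0 := by exact_mod_cast ZMod.natCast_self p
  rw [hp0, zero_dvd_iff, mul_eq_zero] at hdvd
  have hC' : (C : ZMod p) ≠ 0 := by rwa [ne_eq, ZMod.intCast_zmod_eq_zero_iff_dvd]
  have hc'' : (c' : ZMod p) ≠ 0 := by rwa [ne_eq, ZMod.intCast_zmod_eq_zero_iff_dvd]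
  rcases hdvd with h0 | hcube
  · exact hC' h0
  · -- `(t̄ − s)³ = c′`: `c′` is a cube, so its `(p−1)/3`-th power is `1` — against the certificate
    have hcube' : (tb - (s : ZMod p)) ^ 3 = (c' : ZMod p) := sub_eq_zero.mp hcube
    have hone := pow_div_three_eq_one_of_cube (p := p) hp3 hc'' hcube'
    apply hpow
    -- transport the `ZMod p` identity to the `ℕ` computation of the certificate
    have hn : (((c' % (p : ℤ)).toNat : ℕ) : ZMod p) = (c' : ZMod p) := by
      have h0 : (0 : ℤ) ≤ c' % (p : ℤ) := Int.emod_nonneg _ (by exact_mod_cast hp.out.ne_zero)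
      rw [show (((c' % (p : ℤ)).toNat : ℕ) : ZMod p) = (((c' % (p : ℤ)).toNat : ℤ) : ZMod p) by push_cast; rfl,
        Int.toNat_of_nonneg h0, ZMod.intCast_mod]
    have hval := congrArg ZMod.val (show (((c' % (p : ℤ)).toNat ^ ((p - 1) / 3) % p : ℕ) : ZMod p) = 1 by
      rw [ZMod.natCast_mod, Nat.cast_pow, hn, hone])
    rwa [ZMod.val_natCast, Nat.mod_mod, ZMod.val_one] at hval

/-- **Soundness of the descent cover.** If `nodeOK p cert fuel a j L d` then every root `y ∈ ℤ_p` of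
`L` gives a point `x = a + p^j y` inside a certified ball: `‖x − cᵢ‖ ≤ p^{-(mᵢ+1)}` for some entry
`(cᵢ, mᵢ, Nᵢ)` of `cert`. [folklore] -/
theorem inBall_of_nodeOK (cert : List (ℤ × ℕ × ℕ)) : ∀ (fuel : ℕ) (a : ℤ) (j : ℕ) (L : List ℤ) (d : DCert),
    nodeOK p cert fuel a j L d = true → ∀ y : ℤ_[p], aeval y (ofList L) = 0 →
      ∃ e ∈ cert, ‖((a : ℤ_[p]) + (p : ℤ_[p]) ^ j * y) - (e.1 : ℤ_[p])‖ ≤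
        (p : ℝ) ^ (-((e.2.1 + 1 : ℕ) : ℤ))
  | 0, _, _, _, _, h, _, _ => by simp [nodeOK] at h
  | _ + 1, _, _, L, .cubeDead C s c', h, y, hy => absurd hy (aeval_ne_zero_of_cubeDeadOK h y)
  | fuel + 1, a, j, L, .node lc lin kids, h, y, hy => by
    simp only [nodeOK, Bool.and_eq_true, Bool.not_eq_true', beq_eq_false_iff_ne, ne_eq,
      emod_eq_zero_iff_dvd', List.all_eq_true] at h
    obtain ⟨⟨hlc, hcongr⟩, hres⟩ := h
    have hp1 : 1 < (p : ℝ) := by exact_mod_cast hp.out.one_lt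
    -- `p ∣ lc · ∏ (y − sᵢ)^{eᵢ}` in `ℤ_p`
    have hdvd : (p : ℤ_[p]) ∣ aeval y (ofList (prodLinList lc lin)) := by
      have h1 := dvd_aeval_sub_of_congrList₀ y p L (prodLinList lc lin) hcongr
      rw [hy, zero_sub, dvd_neg] at h1
      exact_mod_cast h1
    rcases dvd_intCast_or_exists_dvd_sub_of_dvd_aeval_prodLinList y lc lin hdvd with h1 | ⟨se, hse, h2⟩
    · exact absurd ((PadicInt.norm_int_lt_one_iff_dvd lc).mp ((PadicInt.norm_lt_one_iff_dvd _).mpr h1)) hlc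
    · -- `y` is in the class of the listed residue `se.1`
      have hys : ‖y - (se.1 : ℤ_[p])‖ ≤ (p : ℝ) ^ (-((0 + 1 : ℕ) : ℤ)) := norm_le_inv_of_dvd h2
      have hok := hres se hse
      simp only [Bool.or_eq_true] at hok
      rcases hok with (hball | hdead) | hkids
      · -- an `x`-level certified ball of level `≤ j + 1` is centred in the class of `a + p^j s`
        simp only [inBall, List.any_eq_true, Bool.and_eq_true, decide_eq_true_eq, beq_iff_eq,
          emod_eq_zero_iff_dvd'] at hball
        obtain ⟨e, he, hm, hre1⟩ := hball
        refine ⟨e, he, ?_⟩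
        have hA : ‖(p : ℤ_[p]) ^ j * (y - (se.1 : ℤ_[p]))‖ ≤ (p : ℝ) ^ (-((e.2.1 + 1 : ℕ) : ℤ)) := by
          rw [norm_mul, norm_pow, PadicInt.norm_p]
          calc ((p : ℝ)⁻¹) ^ j * ‖y - (se.1 : ℤ_[p])‖
              ≤ ((p : ℝ)⁻¹) ^ j * (p : ℝ) ^ (-((0 + 1 : ℕ) : ℤ)) :=
                mul_le_mul_of_nonneg_left hys (by positivity)
            _ = (p : ℝ) ^ (-((j + 1 : ℕ) : ℤ)) := by
                rw [← zpow_natCast, ← zpow_neg_one, ← zpow_mul, ← zpow_add₀ (by positivity)]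
                congr 1; push_cast; ring
            _ ≤ (p : ℝ) ^ (-((e.2.1 + 1 : ℕ) : ℤ)) := by
                apply zpow_le_zpow_right₀ hp1.le; push_cast; omega
        have hB : ‖(((a + (p : ℤ) ^ j * se.1 - e.1 : ℤ)) : ℤ_[p])‖ ≤ (p : ℝ) ^ (-((e.2.1 + 1 : ℕ) : ℤ)) :=
          norm_intCast_le_of_dvd hre1
        calc ‖((a : ℤ_[p]) + (p : ℤ_[p]) ^ j * y) - (e.1 : ℤ_[p])‖
            = ‖(p : ℤ_[p]) ^ j * (y - (se.1 : ℤ_[p])) + (((a + (p : ℤ) ^ j * se.1 - e.1 : ℤ)) : ℤ_[p])‖ := by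
              congr 1; push_cast; ring
          _ ≤ max ‖(p : ℤ_[p]) ^ j * (y - (se.1 : ℤ_[p]))‖ ‖(((a + (p : ℤ) ^ j * se.1 - e.1 : ℤ)) : ℤ_[p])‖ :=
              PadicInt.nonarchimedean _ _
          _ ≤ (p : ℝ) ^ (-((e.2.1 + 1 : ℕ) : ℤ)) := max_le hA hB
      · -- the class holds no root of `L`: contradiction
        exact absurd hy (aeval_ne_zero_of_dead hdead (by simpa using hys))
      · -- a checked descent: `y = s + p t`, `L₁(t) = 0`, recurse one level down
        simp only [List.any_eq_true, Bool.and_eq_true, beq_iff_eq] at hkids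
        obtain ⟨kd, -, ⟨hks, hdesc⟩, hrec⟩ := hkids
        obtain ⟨t, ht⟩ := exists_eq_add_mul_of_norm_le y (se.1 : ℤ_[p]) hys
        have hL1 : aeval t (ofList kd.2.2.1) = 0 := by
          have h1 := aeval_descent (A := ℤ_[p]) hdesc t
          rw [← ht, hy] at h1
          have hp0 : (p : ℤ_[p]) ^ kd.2.1 ≠ 0 := pow_ne_zero _ (by exact_mod_cast hp.out.ne_zero)
          exact (mul_eq_zero.mp h1.symm).resolve_left hp0
        obtain ⟨e, he, hle⟩ := inBall_of_nodeOK cert fuel _ _ _ _ hrec t hL1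
        refine ⟨e, he, ?_⟩
        have : ((a : ℤ_[p]) + (p : ℤ_[p]) ^ j * y) =
            (((a + (p : ℤ) ^ j * se.1 : ℤ)) : ℤ_[p]) + (p : ℤ_[p]) ^ (j + 1) * t := by
          rw [ht]; push_cast; ring
        rw [this]; exact hle

/-- **Soundness at the top**: if `nodeOK p cert fuel 0 0 l d` then every root of `F = ofList l` in `ℤ_p`
lies in a certified ball — the hypothesis `hcov` of p17's `RootCensus.exists_roots_of_cover`. [folklore] -/
theorem inBall_of_nodeOK_zero {l : List ℤ} {cert : List (ℤ × ℕ × ℕ)} {fuel : ℕ} {d : DCert}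
    (h : nodeOK p cert fuel 0 0 l d = true) (z : ℤ_[p]) (hz : aeval z (ofList l) = 0) :
    ∃ e ∈ cert, ‖z - (e.1 : ℤ_[p])‖ ≤ (p : ℝ) ^ (-((e.2.1 + 1 : ℕ) : ℤ)) := by
  simpa using inBall_of_nodeOK cert fuel 0 0 l d h z hz

/-- **ROOT CENSUS** for the checker `RootCensus.check₅` (descent-cover certificate): the roots of
`F = ofList l` in `ℤ_p` are exactly `cert.length` pairwise distinct Hensel roots, the `i`-th within
`p^{-(Nᵢ − mᵢ)}` of `cᵢ` — p17's `exists_roots_of_cover` with the cover supplied by `inBall_of_nodeOK_zero`;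
same conclusion as `exists_roots_of_check₂` / `exists_roots_of_check₃`. [folklore] -/
theorem exists_roots_of_check₅ (l : List ℤ) (k : ℕ) (cert : List (ℤ × ℕ × ℕ)) (fuel : ℕ) (d : DCert)
    (h : check₅ p l k cert fuel d = true) :
    ∃ ρ : Fin cert.length → ℤ_[p], Function.Injective ρ ∧
      (∀ i, aeval (ρ i) (ofList l) = 0 ∧
        ‖ρ i - ((cert.get i).1 : ℤ_[p])‖ < (p : ℝ) ^ (-((cert.get i).2.1 : ℤ)) ∧
        ‖ρ i - ((cert.get i).1 : ℤ_[p])‖ ≤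
          (p : ℝ) ^ (-(((cert.get i).2.2 - (cert.get i).2.1 : ℕ) : ℤ))) ∧
      ∀ z : ℤ_[p], aeval z (ofList l) = 0 → ∃ i, ρ i = z := by
  simp only [check₅, Bool.and_eq_true, List.all_eq_true] at h
  obtain ⟨⟨hent, hpw⟩, hcov⟩ := h
  exact exists_roots_of_cover l k cert hent hpw (inBall_of_nodeOK_zero hcov)

/-! ### Instances -/

/-- Sanity check: `X² − 7` over `ℤ₃` as a one-node descent certificate (no descent needed). [folklore] -/
example : check₅ 3 [-7, 0, 1] 1 [((1 : ℤ), 0, 1), (-1, 0, 1)] 1 (.node 1 [((1 : ℤ), 1), (2, 1)] []) = true := by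
  decide

/-- The smallest genuine descent: `X² − 63` over `ℤ₃`: `X² − 63 ≡ X² (mod 3)` has the DOUBLE root `0`, neither a simple
ball nor dead at level 1 (`63 = 9·7`); the descent `F(3Y) = 9·(Y² − 7)` lands on `Y² − 7 ≡ (Y − 1)(Y − 2)`,
whose classes carry the two depth-`1` balls `(3, 1, 3)`, `(−3, 1, 3)` of `F` (`x = 3y`). [folklore] -/
example : check₅ 3 [-63, 0, 1] 2 [((3 : ℤ), 1, 3), (-3, 1, 3)] 2
    (.node 1 [((0 : ℤ), 2)] [((0 : ℤ), 2, [-7, 0, 1], .node 1 [((1 : ℤ), 1), (2, 1)] [])]) = true := by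
  decide

/-- The cube-class leaf alone: `Y³ − 2` over `ℤ₇` (`7 ≡ 1 (mod 3)`, `2^{(7−1)/3} = 4 ≢ 1`: `2` is not a
cube mod `7`) has NO root — zero balls, the whole certificate is one `cubeDead` leaf. [folklore] -/
example : check₅ 7 [-2, 0, 0, 1] 1 [] 1 (.cubeDead 1 0 2) = true := by
  decide

end Summit.BirchSwinnertonDyer.Rank1Residual.GaloisImage.RootCensus
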